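import Summits.ValiantsHypothesis.ValiantsHypothesis.Theses.BarrierLever
import Literature.Combinatorics.Extremal.LowDegreeSurfaceThroughLines

/-!
# Route BarrierLever — item 20023 `HittingSetFormatCeiling` (coefficient axis of the V4 door)

Item `stmt-ValiantsHypothesis-20023` (support, rank 9; planner p2-g7, cell valiant-natproofs, rung V4,
bears_on crux stmt-ValiantsHypothesis-14610 = FSV Question 6 — it neither restates nor weakens the crux).
FORMAT CEILING for hitting-set equations: fix `n`, a nonempty finite `H ⊆ ℤⁿ` and magnitudes `A, M`. If an
equation `P` in the coefficient variables (indexed by `degLEMonomials n`) vanishes at every `f` of total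
degree `≤ n` with INTEGER coefficients of modulus `≤ A + M` that is nonzero somewhere on `H` — the vanishing
format of the CKRST'20 equations (arXiv:2004.14147, Thm 1.5 / Thm 4.3; tree:
`CKRST2020.exists_equation_intBox`) — and `P` is nonzero at some `g` with integer coefficients of modulus
`≤ A` vanishing on all of `H`, then `2M ≤ totalDegree P`.

**Proof** (the planner's, re-derived here against the tree's line-restriction lemmas
`Literature.Combinatorics.Extremal.{eval_aeval_line, card_filter_eval_line_eq_zero_le}` because the
attached scratch file is not readable from a prover jail): restrict `P` to the line
`s ↦ coeffVector (g + C s) = coeffVector g + s • e₀` (`e₀` = the indicator of the constant monomial).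
Constant shifts keep `totalDegree ≤ n` and integrality, with modulus `≤ A + |s|`, and `g + C s` takes the
value `s ≠ 0` at any point of `H`; so the restriction — nonzero at `s = 0` — vanishes at the `2M` integers
`s = ±1, …, ±M`, whence `2M ≤ deg`.

WHAT THIS IS NOT: a statement about the FORMAT of hitting-set equations only (linear degree-in-magnitude
is necessary for the exclusion format, answering CKRST §6's «better dependence» question negatively for
that format); nothing about FSV Question 6 itself, crux 14610, or VP vs VNP.
-/

-- layout Summits/ValiantsHypothesis/ValiantsHypothesis forces the duplicated namespace component
set_option linter.dupNamespace false

namespace Summit.ValiantsHypothesis.ValiantsHypothesis.Theorems.BarrierLever.FormatCeiling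

open MvPolynomial Literature.Barriers.ValiantsHypothesis

/-- The coefficient vector of a constant shift: `coeffVector (g + C t) = coeffVector g + t • e₀`,
`e₀` the indicator of the zero exponent. -/
theorem coeffVector_add_C {n : ℕ} (g : MvPolynomial (Fin n) ℂ) (t : ℂ) :
    coeffVector (degLEMonomials n) (g + C t) =
      coeffVector (degLEMonomials n) g +
        t • (fun m : degLEMonomials n => if (m : Fin n →₀ ℕ) = 0 then (1 : ℂ) else 0) := by
  classical
  funext m
  simp only [coeffVector_apply, Pi.add_apply, Pi.smul_apply, smul_eq_mul, coeff_add, coeff_C]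
  by_cases hm : (m : Fin n →₀ ℕ) = 0
  · rw [if_pos hm.symm, if_pos hm, mul_one]
  · rw [if_neg (Ne.symm hm), if_neg hm, mul_zero]

/-- A constant shift of a polynomial of total degree `≤ n` has total degree `≤ n`. -/
theorem totalDegree_add_C_le {n : ℕ} {g : MvPolynomial (Fin n) ℂ} (hg : g.totalDegree ≤ n) (t : ℂ) :
    (g + C t).totalDegree ≤ n :=
  (totalDegree_add _ _).trans (max_le hg (by rw [totalDegree_C]; exact Nat.zero_le _))

/-- A constant INTEGER shift by `k`, `|k| ≤ M`, of a polynomial with integer coefficients of modulus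
`≤ A` has integer coefficients of modulus `≤ A + M`. -/
theorem coeff_add_C_int {n A M : ℕ} {g : MvPolynomial (Fin n) ℂ}
    (hgi : ∀ m : Fin n →₀ ℕ, ∃ z : ℤ, MvPolynomial.coeff m g = (z : ℂ) ∧ |z| ≤ ((A : ℕ) : ℤ))
    (k : ℤ) (hk : |k| ≤ (M : ℤ)) (m : Fin n →₀ ℕ) :
    ∃ z : ℤ, MvPolynomial.coeff m (g + C (k : ℂ)) = (z : ℂ) ∧ |z| ≤ ((A + M : ℕ) : ℤ) := by
  classical
  obtain ⟨z, hz, hzA⟩ := hgi m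
  refine ⟨z + if (0 : Fin n →₀ ℕ) = m then k else 0, ?_, ?_⟩
  · rw [coeff_add, coeff_C, hz]
    push_cast
    split_ifs <;> simp
  · have h1 : |(if (0 : Fin n →₀ ℕ) = m then k else 0)| ≤ (M : ℤ) := by
      split_ifs
      · exact hk
      · simp
    calc |z + (if (0 : Fin n →₀ ℕ) = m then k else 0)|
        ≤ |z| + |(if (0 : Fin n →₀ ℕ) = m then k else 0)| := abs_add_le _ _
      _ ≤ (A : ℤ) + (M : ℤ) := add_le_add hzA h1
      _ = ((A + M : ℕ) : ℤ) := by push_cast; ring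

/-- **Item 20023 `HittingSetFormatCeiling`** (the route decl, by name). -/
theorem hittingSetFormatCeiling : Theses.BarrierLever.HittingSetFormatCeiling := by
  classical
  intro n A M H hH P hP g hg hgi hgH hgP
  -- the line through `coeffVector g` in the direction of the constant coefficient
  set a : degLEMonomials n → ℂ := coeffVector (degLEMonomials n) g with ha
  set v : degLEMonomials n → ℂ := fun m => if (m : Fin n →₀ ℕ) = 0 then (1 : ℂ) else 0 with hv
  have hline : ∀ t : ℂ, a + t • v = coeffVector (degLEMonomials n) (g + C t) := by
    intro t
    rw [ha, hv, coeffVector_add_C]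
  -- the restriction of `P` to the line is not the zero polynomial (value at `t = 0`)
  have hres : MvPolynomial.aeval
      (fun i => Polynomial.C (a i) + Polynomial.C (v i) * Polynomial.X) P ≠ 0 := by
    intro h0
    apply hgP
    have h1 := Literature.Combinatorics.Extremal.eval_aeval_line a v P 0
    rw [h0, Polynomial.eval_zero, zero_smul, add_zero] at h1
    exact h1.symm
  -- the 2M nonzero integers of modulus ≤ M, as complex numbers
  set T : Finset ℂ := ((Finset.Icc (-(M : ℤ)) M).erase 0).image (fun k : ℤ => (k : ℂ)) with hT
  have hTcard : T.card = 2 * M := by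
    rw [hT, Finset.card_image_of_injective _ Int.cast_injective,
      Finset.card_erase_of_mem (by simp), Int.card_Icc]
    omega
  -- `P` vanishes at every point `a + t v`, `t ∈ T`
  obtain ⟨x₀, hx₀⟩ := hH
  have hvan : ∀ t ∈ T, MvPolynomial.eval (a + t • v) P = 0 := by
    intro t ht
    rw [hT, Finset.mem_image] at ht
    obtain ⟨k, hk, rfl⟩ := ht
    rw [Finset.mem_erase, Finset.mem_Icc] at hk
    have hkM : |k| ≤ (M : ℤ) := abs_le.mpr hk.2
    rw [hline]
    refine hP (g + C (k : ℂ)) (totalDegree_add_C_le hg _) (coeff_add_C_int hgi k hkM) ?_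
    refine ⟨x₀, hx₀, ?_⟩
    rw [map_add, eval_C, hgH x₀ hx₀, zero_add]
    exact_mod_cast hk.1
  -- Bézout on the line: at most `totalDegree P` of the `2M` points are zeros
  have hle := Literature.Combinatorics.Extremal.card_filter_eval_line_eq_zero_le a v P T hres
  rw [Finset.filter_true_of_mem hvan, hTcard] at hle
  exact hle

end Summit.ValiantsHypothesis.ValiantsHypothesis.Theorems.BarrierLever.FormatCeiling
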